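import Summits.AtomisticToContinuum.FouriersLaw.Theorems.OddSectorIrreversibilityOddDensityIsCorrectorDensity
import Literature.Barriers.AtomisticToContinuum.MazurBoundBallisticOpenChain
import Literature.Barriers.AtomisticToContinuum.SpectralGapClosingEquilibrium

/-!
# `OddDensityIsCorrector`, part 13: the McLennan source is a coboundary plus the total current

Helper file for support item `stmt-AtomisticToContinuum-9146`
(`OddSectorIrreversibility.OddDensityIsCorrector`).

The two exact energy identities of the open chain (Kundu–Dhar–Narayan (reln3)):
`L H = γ(T - p_0²) + γ(T - p_{N-1}²)` (`generator_hamiltonian_two_baths`, PROVED in the tree) and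
`L X = J_tot + γ(N-1)(T - p_{N-1}²)` for the energy first moment `X = energyMoment` (`{H, X} = J_tot`,
`sum_bondCurrent_eq_poisson`, PROVED in the tree; the bath terms act on `p_{N-1}` with weight `N-1`).
Hence for `N ≥ 2` the smooth, momentum-EVEN observable

  `Ψ = X / ((N-1)T²) - H / (2T²)`   satisfies   `L Ψ = J_tot / ((N-1)T²) + g`,

`g = γ(p_0² - p_{N-1}²)/(2T²)` the McLennan source of the response density
(`pinnedChain_generator_mclennanPotential`). This file also records the growth bounds
`|J_tot|, |g|, |Ψ|, |LΨ| ≤ C e^{ϑH}` (`0 < ϑ`) and the evenness of `Ψ` used by the assembly.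
Nothing here closes an item.
-/

noncomputable section

open MeasureTheory Filter Topology Set Function Finset
open scoped ContDiff NNReal ENNReal BigOperators
open Literature.MathematicalPhysics.KineticTheory.HeatConduction
open Literature.Barriers.AtomisticToContinuum.OpenChain

namespace Summit.AtomisticToContinuum.FouriersLaw.Theorems.OddSectorIrreversibility

variable {N : ℕ}

/-! ### `∂²_{p_i} X = i`, smoothness and evenness of `X` -/

/-- `∂²_{p_i} X = i` for the energy first moment. [folklore] -/
theorem partialP_partialP_energyMoment (P : OscillatorChain) (i : Fin N) (x : PhaseSpace N) :
    partialP i (partialP i (energyMoment P N)) x = (i.val : ℝ) := by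
  have h : partialP i (energyMoment P N) = fun y : PhaseSpace N => (i.val : ℝ) * y.2 i :=
    funext fun y => partialP_energyMoment P i y
  rw [h]
  unfold partialP
  simp only [Function.update_self]
  rw [deriv_const_mul _ differentiableAt_id, deriv_id'', mul_one]

/-- The energy first moment of a chain with smooth potentials is smooth. [folklore] -/
theorem contDiff_energyMoment (P : OscillatorChain) (hU : ContDiff ℝ ∞ P.U) (hV : ContDiff ℝ ∞ P.V) (N : ℕ) :
    ContDiff ℝ ∞ (energyMoment P N) := by
  unfold energyMoment
  refine ContDiff.add (ContDiff.sum fun k _ => contDiff_const.mul ?_) (ContDiff.sum fun k _ => ContDiff.sum fun l _ => ?_)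
  · exact (((((contDiff_apply ℝ ℝ k).comp contDiff_snd).pow 2).div_const 2).add
      (hU.comp ((contDiff_apply ℝ ℝ k).comp contDiff_fst)))
  · by_cases hlk : l.val = k.val + 1
    · simp only [hlk, if_true]
      exact contDiff_const.mul (hV.comp (((contDiff_apply ℝ ℝ l).comp contDiff_fst).sub
        ((contDiff_apply ℝ ℝ k).comp contDiff_fst)))
    · simp only [hlk, if_false]
      exact contDiff_const

/-- `X` is even in the momenta. [folklore] -/
theorem energyMoment_neg_momentum (P : OscillatorChain) (N : ℕ) (x : PhaseSpace N) :
    energyMoment P N (x.1, -x.2) = energyMoment P N x := by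
  unfold energyMoment
  simp only [Pi.neg_apply, neg_sq]

/-! ### `L X = J_tot + γ(N-1)(T - p_{N-1}²)` and `L Ψ = J_tot/((N-1)T²) + g` -/

section Pinned

variable {ω₂ lam β γ : ℝ} (hN : 2 ≤ N) (T : ℝ)
include hN

/-- **`L X = J_tot + γ (N-1)(T - p_{N-1}²)`** for the energy first moment `X` of the pinned chain with
both baths at `T` (`{H, X} = J_tot`, `sum_bondCurrent_eq_poisson`; the bath at site `N-1` acts on `X`
through `∂_{p_{N-1}} X = (N-1) p_{N-1}`, the one at site `0` through `∂_{p_0}X = 0`).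
[cite: KunduDharNarayan2009, eq. (reln3)] -/
theorem pinnedChain_generator_energyMoment (x : PhaseSpace N) :
    (pinnedChain ω₂ lam β γ).generator N T T (energyMoment (pinnedChain ω₂ lam β γ) N) x =
      (∑ i : Fin N, (pinnedChain ω₂ lam β γ).bondCurrent N i x) +
        γ * (((N : ℝ) - 1) * (T - x.2 ⟨N - 1, by omega⟩ ^ 2)) := by
  set P := pinnedChain ω₂ lam β γ with hP
  have hU : Differentiable ℝ P.U := (pinnedChain_contDiff_U ω₂ lam β γ (n := 1)).differentiable one_ne_zero
  have hV : Differentiable ℝ P.V := (pinnedChain_contDiff_V ω₂ lam β γ (n := 1)).differentiable one_ne_zero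
  have hγ' : P.γ = γ := rfl
  unfold OscillatorChain.generator
  -- Liouville part = Poisson bracket
  have hL : (∑ i : Fin N, (x.2 i * partialQ i (energyMoment P N) x -
      partialQ i (P.hamiltonian N) x * partialP i (energyMoment P N) x)) = ∑ i : Fin N, P.bondCurrent N i x := by
    rw [sum_bondCurrent_eq_poisson P hU hV N x]
    unfold poisson
    refine Finset.sum_congr rfl fun i _ => ?_
    rw [P.partialP_hamiltonian]
  rw [hL, hγ']
  congr 1
  -- bath part
  have hb : ∀ i : Fin N, T * partialP i (partialP i (energyMoment P N)) x - x.2 i * partialP i (energyMoment P N) x =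
      (i.val : ℝ) * (T - x.2 i ^ 2) := fun i => by
    rw [partialP_partialP_energyMoment, partialP_energyMoment]; ring
  simp only [hb]
  rw [sum_ite_ends_eq hN (fun i : Fin N => (i.val : ℝ) * (T - x.2 i ^ 2))]
  have h1 : (((⟨N - 1, by omega⟩ : Fin N).val : ℕ) : ℝ) = (N : ℝ) - 1 := by
    simp only [Nat.cast_pred (by omega : 0 < N)]
  simp only [Nat.cast_zero, zero_mul, zero_add]
  rw [h1]

/-- **`L Ψ = J_tot/((N-1)T²) + g`** for `Ψ = X/((N-1)T²) - H/(2T²)` (`N ≥ 2`, `T ≠ 0`), with the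
McLennan source `g = γ (p_0² - p_{N-1}²)/(2T²)`. [cite: KunduDharNarayan2009, eq. (reln3)] -/
theorem pinnedChain_generator_mclennanPotential (hT : T ≠ 0) (x : PhaseSpace N) :
    (pinnedChain ω₂ lam β γ).generator N T T (fun y => (((N : ℝ) - 1) * T ^ 2)⁻¹ * energyMoment (pinnedChain ω₂ lam β γ) N y +
        (-(2 * T ^ 2)⁻¹) * (pinnedChain ω₂ lam β γ).hamiltonian N y) x =
      (((N : ℝ) - 1) * T ^ 2)⁻¹ * (∑ i : Fin N, (pinnedChain ω₂ lam β γ).bondCurrent N i x) +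
        γ / (2 * T ^ 2) * (x.2 ⟨0, by omega⟩ ^ 2 - x.2 ⟨N - 1, by omega⟩ ^ 2) := by
  set P := pinnedChain ω₂ lam β γ with hP
  have hU : ContDiff ℝ ∞ P.U := pinnedChain_contDiff_U ω₂ lam β γ
  have hV : ContDiff ℝ ∞ P.V := pinnedChain_contDiff_V ω₂ lam β γ
  have hX2 : ContDiff ℝ 2 (fun y => (((N : ℝ) - 1) * T ^ 2)⁻¹ * energyMoment P N y) :=
    contDiff_const.mul ((contDiff_energyMoment P hU hV N).of_le (by norm_cast))
  have hH2 : ContDiff ℝ 2 (fun y => (-(2 * T ^ 2)⁻¹) * P.hamiltonian N y) :=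
    contDiff_const.mul ((P.contDiff_hamiltonian hU hV N).of_le (by norm_cast))
  rw [generator_add P N T T hX2 hH2, generator_const_mul, generator_const_mul,
    pinnedChain_generator_energyMoment hN T x,
    Literature.Barriers.AtomisticToContinuum.generator_hamiltonian_two_baths P hN T T x]
  have hN1 : (N : ℝ) - 1 ≠ 0 := by
    have : (2 : ℝ) ≤ N := by exact_mod_cast hN
    linarith
  have hγ' : P.γ = γ := rfl
  rw [hγ']
  field_simp
  ring

end Pinned

/-! ### Growth bounds: `(1 + H)² ≤ c_ϑ e^{ϑH}` and the observables of the assembly -/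

section Bounds

variable {ω₂ lam β γ : ℝ} (hω : 0 < ω₂) (hl : 0 ≤ lam) (hβ : 0 ≤ β) (N : ℕ)
include hω hl hβ

/-- `(1 + H)² ≤ (2e^{ϑ}/ϑ²) e^{ϑH}` (`ϑ > 0`). [folklore] -/
theorem pinnedChain_one_add_hamiltonian_sq_le {ϑ : ℝ} (hϑ : 0 < ϑ) (x : PhaseSpace N) :
    (1 + (pinnedChain ω₂ lam β γ).hamiltonian N x) ^ 2 ≤
      2 * Real.exp ϑ / ϑ ^ 2 * Real.exp (ϑ * (pinnedChain ω₂ lam β γ).hamiltonian N x) :=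
  one_add_sq_le_exp (pinnedChain_hamiltonian_nonneg hω.le hl hβ γ N x) hϑ

/-- **The total current is nice**: `|J_tot| ≤ C e^{ϑH}` with `C = N²(3+β)/2 · 2e^{ϑ}/ϑ²`. [folklore] -/
theorem pinnedChain_abs_totalCurrent_le {ϑ : ℝ} (hϑ : 0 < ϑ) (x : PhaseSpace N) :
    |∑ i : Fin N, (pinnedChain ω₂ lam β γ).bondCurrent N i x| ≤
      (N * (N * ((3 + β) / 2)) * (2 * Real.exp ϑ / ϑ ^ 2)) * Real.exp (ϑ * (pinnedChain ω₂ lam β γ).hamiltonian N x) := by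
  have h1 := pinnedChain_one_add_hamiltonian_sq_le hω hl hβ N (γ := γ) hϑ x
  have hJ : ∀ i : Fin N, |(pinnedChain ω₂ lam β γ).bondCurrent N i x| ≤
      N * ((3 + β) / 2 * (1 + (pinnedChain ω₂ lam β γ).hamiltonian N x) ^ 2) :=
    fun i => pinnedChain_abs_bondCurrent_le hω.le hl hβ γ N i x
  calc |∑ i : Fin N, (pinnedChain ω₂ lam β γ).bondCurrent N i x|
      ≤ ∑ i : Fin N, |(pinnedChain ω₂ lam β γ).bondCurrent N i x| := abs_sum_le_sum_abs _ _
    _ ≤ ∑ _i : Fin N, N * ((3 + β) / 2 * (1 + (pinnedChain ω₂ lam β γ).hamiltonian N x) ^ 2) := sum_le_sum fun i _ => hJ i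
    _ = N * (N * ((3 + β) / 2 * (1 + (pinnedChain ω₂ lam β γ).hamiltonian N x) ^ 2)) := by
        rw [sum_const, card_univ, Fintype.card_fin, nsmul_eq_mul]
    _ ≤ (N * (N * ((3 + β) / 2)) * (2 * Real.exp ϑ / ϑ ^ 2)) * Real.exp (ϑ * (pinnedChain ω₂ lam β γ).hamiltonian N x) := by
        have hβ3 : 0 ≤ (3 + β) / 2 := by linarith
        have : (N : ℝ) * (N * ((3 + β) / 2 * (1 + (pinnedChain ω₂ lam β γ).hamiltonian N x) ^ 2)) =
            (N * (N * ((3 + β) / 2))) * (1 + (pinnedChain ω₂ lam β γ).hamiltonian N x) ^ 2 := by ring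
        rw [this, mul_assoc (↑N * (↑N * ((3 + β) / 2)))]
        exact mul_le_mul_of_nonneg_left h1 (by positivity)

/-- `p_i² ≤ 2H`. [folklore] -/
theorem pinnedChain_sq_momentum_le (x : PhaseSpace N) (i : Fin N) :
    x.2 i ^ 2 ≤ 2 * (pinnedChain ω₂ lam β γ).hamiltonian N x := by
  have hsum := pinnedChain_harmonic_le_hamiltonian (ω₂ := ω₂) hl hβ γ N x
  have h1 : 0 ≤ ∑ j, ω₂ * x.1 j ^ 2 / 2 := sum_nonneg fun j _ => by positivity
  have h2 : x.2 i ^ 2 / 2 ≤ ∑ j, x.2 j ^ 2 / 2 :=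
    single_le_sum (f := fun j => x.2 j ^ 2 / 2) (fun j _ => by positivity) (mem_univ _)
  linarith

/-- **The McLennan source is nice**: `|g| ≤ (|γ|/T² · 2e^{ϑ}/ϑ²) e^{ϑH}` for
`g = γ(p_a² - p_b²)/(2T²)` and any two sites `a, b`. [folklore] -/
theorem pinnedChain_abs_mclennanSource_le {T ϑ : ℝ} (hϑ : 0 < ϑ) (a b : Fin N) (x : PhaseSpace N) :
    |γ / (2 * T ^ 2) * (x.2 a ^ 2 - x.2 b ^ 2)| ≤
      (|γ| / T ^ 2 * (2 * Real.exp ϑ / ϑ ^ 2)) * Real.exp (ϑ * (pinnedChain ω₂ lam β γ).hamiltonian N x) := by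
  set H := (pinnedChain ω₂ lam β γ).hamiltonian N x with hH
  have hH0 : 0 ≤ H := pinnedChain_hamiltonian_nonneg hω.le hl hβ γ N x
  have ha := pinnedChain_sq_momentum_le hω hl hβ N (γ := γ) x a
  have hb := pinnedChain_sq_momentum_le hω hl hβ N (γ := γ) x b
  have h1 := pinnedChain_one_add_hamiltonian_sq_le hω hl hβ N (γ := γ) hϑ x
  have hdiff : |x.2 a ^ 2 - x.2 b ^ 2| ≤ 2 * H := by
    rw [abs_le]; constructor <;> nlinarith [sq_nonneg (x.2 a), sq_nonneg (x.2 b)]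
  have h2H : 2 * H ≤ 2 * (1 + H) ^ 2 := by nlinarith
  rw [abs_mul, abs_div, abs_of_nonneg (by positivity : (0 : ℝ) ≤ 2 * T ^ 2)]
  calc |γ| / (2 * T ^ 2) * |x.2 a ^ 2 - x.2 b ^ 2| ≤ |γ| / (2 * T ^ 2) * (2 * (1 + H) ^ 2) :=
        mul_le_mul_of_nonneg_left (hdiff.trans h2H) (by positivity)
    _ = |γ| / T ^ 2 * (1 + H) ^ 2 := by ring
    _ ≤ |γ| / T ^ 2 * (2 * Real.exp ϑ / ϑ ^ 2 * Real.exp (ϑ * H)) := mul_le_mul_of_nonneg_left h1 (by positivity)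
    _ = _ := by ring

/-- `0 ≤ X ≤ 2N·H` for the energy first moment of the pinned chain (all site energies are
nonnegative and carry weights `≤ N`). [folklore] -/
theorem pinnedChain_abs_energyMoment_le (x : PhaseSpace N) :
    |energyMoment (pinnedChain ω₂ lam β γ) N x| ≤ 2 * N * (pinnedChain ω₂ lam β γ).hamiltonian N x := by
  set P := pinnedChain ω₂ lam β γ with hP
  have hU0 : ∀ q : ℝ, 0 ≤ P.U q := fun q => by show 0 ≤ ω₂ * q ^ 2 / 2 + lam * q ^ 4 / 4; positivity
  have hV0 : ∀ r : ℝ, 0 ≤ P.V r := fun r => by show 0 ≤ r ^ 2 / 2 + β * r ^ 4 / 4; positivity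
  set A := ∑ k : Fin N, (x.2 k ^ 2 / 2 + P.U (x.1 k)) with hA
  set B := ∑ k : Fin N, ∑ l : Fin N, (if l.val = k.val + 1 then P.V (x.1 l - x.1 k) else 0) with hB
  have hHAB : P.hamiltonian N x = A + B := rfl
  have hA0 : 0 ≤ A := sum_nonneg fun k _ => add_nonneg (by positivity) (hU0 _)
  have hB0 : 0 ≤ B := sum_nonneg fun k _ => sum_nonneg fun l _ => by split_ifs <;> [exact hV0 _; exact le_rfl]
  have hkN : ∀ k : Fin N, (k.val : ℝ) ≤ N := fun k => by exact_mod_cast k.isLt.le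
  -- first part
  have h1 : |∑ k : Fin N, (k.val : ℝ) * (x.2 k ^ 2 / 2 + P.U (x.1 k))| ≤ N * A := by
    rw [abs_of_nonneg (sum_nonneg fun k _ => mul_nonneg (Nat.cast_nonneg _) (add_nonneg (by positivity) (hU0 _))),
      hA, mul_sum]
    exact sum_le_sum fun k _ => mul_le_mul_of_nonneg_right (hkN k) (add_nonneg (by positivity) (hU0 _))
  have h2 : |∑ k : Fin N, ∑ l : Fin N, (if l.val = k.val + 1 then ((k.val : ℝ) + 1 / 2) * P.V (x.1 l - x.1 k) else 0)| ≤ N * B := by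
    have hnn : ∀ k l : Fin N, 0 ≤ (if l.val = k.val + 1 then ((k.val : ℝ) + 1 / 2) * P.V (x.1 l - x.1 k) else 0) :=
      fun k l => by split_ifs <;> [exact mul_nonneg (by positivity) (hV0 _); exact le_rfl]
    rw [abs_of_nonneg (sum_nonneg fun k _ => sum_nonneg fun l _ => hnn k l), hB, mul_sum]
    refine sum_le_sum fun k _ => ?_
    rw [mul_sum]
    refine sum_le_sum fun l _ => ?_
    split_ifs with hlk
    · have hk1 : (k.val : ℝ) + 1 / 2 ≤ N := by
        have : (k.val : ℝ) + 1 ≤ N := by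
          have := l.isLt; have : k.val + 1 < N + 1 := by omega
          exact_mod_cast (by omega : k.val + 1 ≤ N)
        linarith
      exact mul_le_mul_of_nonneg_right hk1 (hV0 _)
    · simp
  unfold energyMoment
  calc _ ≤ |∑ k : Fin N, (k.val : ℝ) * (x.2 k ^ 2 / 2 + P.U (x.1 k))| +
        |∑ k : Fin N, ∑ l : Fin N, (if l.val = k.val + 1 then ((k.val : ℝ) + 1 / 2) * P.V (x.1 l - x.1 k) else 0)| :=
        abs_add_le _ _
    _ ≤ N * A + N * B := add_le_add h1 h2
    _ ≤ 2 * N * P.hamiltonian N x := by rw [hHAB]; nlinarith [Nat.cast_nonneg (α := ℝ) N]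

end Bounds

end Summit.AtomisticToContinuum.FouriersLaw.Theorems.OddSectorIrreversibility

end
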